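import Mathlib.Analysis.Matrix.Spectrum
import Mathlib.Analysis.Matrix.Order
import Mathlib.Analysis.Complex.Basic
import Literature.Analysis.Convex.StrictLMIAlternative
import HarnessLib

/-!
# The Kalman–Yakubovich–Popov lemma, strict version (continuous time, real data)

Topic `Literature/Analysis/Matrix`, namespace `Literature.Analysis.Matrix.KalmanYakubovichPopovLemma`.
Everything is PROVED (no definition, no named fact, no `sorry`; standard axioms).  Companion of
`BoundedRealLemma.lean` (which has only the EASY direction of the discrete-time bounded-real lemma).

## Sources (read on the page)

* A. Megretski, *KYP Lemma for Non-Strict Inequalities and the associated Minimax Theorem*,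
  arXiv:1008.2552 (2010) [Megretski2010] (held text `paper:arxiv-1008.2552`, chunks p0003–p0004
  statements, p0010–p0011 proofs).  §1.2 «KYP Lemma in Continuous Time», the strict-LMI theorem
  (LaTeX label `thm:kyplmisct`, the second theorem of §1.2), verbatim: «For arbitrary matrices
  `A ∈ ℂ^{n,n}`, `B ∈ ℂ^{n,m}`, `Q = Q' ∈ ℂ^{n+m,n+m}` the following conditions are equivalent:
  (a) there exists `P = P' ∈ ℂ^{n,n}` such that the Hermitian form `σ_P : ℂⁿ × ℂᵐ → ℝ` defined by
  `σ_P(x,u) = σ(x,u) + 2Re[x'P(Ax+Bu)]` (k15) is positive definite; (b) the Hermitian form `σ` is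
  positive definite on the subspace `L(s)` for all `s ∈ jℝ ∪ {∞}`, where `L(z)` is defined by
  `L(z) = {(x,u) ∈ ℂⁿ × ℂᵐ : zx = Ax + Bu}` (k6) for `z ∈ ℂ`, and `L(∞) = {0} × ℂᵐ`.  Moreover,
  when matrices `A, B, Q` in (b) are real, the corresponding matrix `P` from (a) can be chosen to
  be real as well.»  (`σ(x,u) = (x;u)'Q(x;u)`, (k1).)  PROOF, §3.2.5 (discrete time) + §3.2.7
  («there is a simple way of deriving the CT versions from the DT ones»): «assume that (b) is true
  but (a) is not … According to the Hahn-Banach theorem there exists … `H = H' ≠ 0` such that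
  `tr(XH) ≤ 0` for all `X ∈ Ω` … `tr(QH) ≤ 0` … `H ≥ 0` … `tr(H(E₀'PE₀ − E₁'PE₁)) = 0` for every
  `P = P'`, i.e. `E₀HE₀' = E₁HE₁'`. The last equality implies existence of a unitary matrix `U`
  such that `UH^{1/2}E₀' = H^{1/2}E₁'` … Let `w₁, …, w_{n+m}` be an orthonormal basis of
  eigenvectors of `U'` … `eᵢ = (xᵢ; uᵢ) = H^{1/2}wᵢ`. By construction, `(xᵢ, uᵢ) ∈ L(zᵢ)`, and
  hence by assumption (b) `eᵢ'Qeᵢ > 0` whenever `eᵢ ≠ 0`. On the other hand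
  `0 ≥ tr(QH) = Σ eᵢ'Qeᵢ`, which means `eᵢ'Qeᵢ = 0` for all `i`. Hence `eᵢ = 0` for all `i` and
  therefore `H = 0`, which contradicts the construction.»
* A. Rantzer, *On the Kalman–Yakubovich–Popov lemma*, Systems Control Lett. 28 (1996) 7–10
  [Rantzer1996] — the original of this convexity proof and of the strict statement without
  controllability (Megretski's reference [Ran1]): Theorem 1, for real `A, B` and `M = Mᵀ` with
  `det(jωI − A) ≠ 0` for `ω ∈ ℝ`: «(i) `[(jωI − A)⁻¹B; I]* M [(jωI − A)⁻¹B; I] ≤ 0`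
  `∀ ω ∈ ℝ ∪ {∞}`; (ii) there exists `P = Pᵀ` such that `M + [AᵀP + PA, PB; BᵀP, 0] ≤ 0` … The
  corresponding equivalence for strict inequalities holds even if `(A, B)` is not controllable.»
  PAYWALLED (`lit read doi:10.1016/0167-6911(95)00063-1` rc 3, acquisition request acq-14051);
  cited for attribution through [Megretski2010], NOT read on the page and not relied on for any
  constant or hypothesis below.

## What is typed (all proved)

Real data `A : Matrix n n ℝ`, `B : Matrix n m ℝ`, `Q = Qᵀ : Matrix (n ⊕ m) (n ⊕ m) ℝ`; the
certificate matrix is written out as the block matrix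
`Q + Matrix.fromBlocks (Aᵀ * P + P * A) (P * B) (Bᵀ * P) 0` (no definition is introduced), and the
frequency side is stated over `ℂ` with `A.map Complex.ofRealHom` etc.; a point of `L(iω)` is a
pair `x : n → ℂ`, `u : m → ℂ` with `A x + B u = (ω i) • x`, the stacked vector is `Sum.elim x u`
and the Hermitian form is `Re (vᴴ Q v) = (star v ⬝ᵥ (Q *ᵥ v)).re`.

* §1 identities of the KYP block: linearity in `P` (`kyp_add/_smul/_sum/_neg`), symmetry
  (`kyp_transpose`), the form identity `(x;u)ᴴ[AᴴP + PA, PB; BᴴP, 0](x;u) =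
  (Ax+Bu)ᴴPx + xᴴP(Ax+Bu)` (`star_dotProduct_kyp_mulVec`), the trace adjoint
  `tr([AᵀP + PA, PB; BᵀP, 0]Z) = tr(P(AZ₁₁ + Z₁₁Aᵀ + BZ₂₁ + Z₁₂Bᵀ))` (`trace_kyp_mul`), and the
  real-to-complex transport (`kyp_map_ofReal`).
* §2 **the complex core** `re_trace_mul_pos_of_coupling` (for COMPLEX `A, B, Q`): if the form of
  `Q` is positive definite on every `L(iω)` and on `L(∞)`, then every family of vectors `E`
  (columns `(x_k; u_k)`) with the coupling `(AX + BY)Xᴴ + X(AX + BY)ᴴ = 0` (the continuous-time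
  form of «`E₀HE₀' = E₁HE₁'`» for `H = EEᴴ`, `coupling_eq_blocks`) has `Re tr(Q·EEᴴ) > 0` unless
  `E = 0`.  The printed alignment step is carried out with Hermitian spectral theorems only
  (Mathlib `Matrix.IsHermitian.eigenvectorUnitary`): Step 1 `exists_unitary_cols_orthogonal`
  (orthogonalise the `x`-columns), Step 2 `exists_unitary_align` (on the support of the
  `x`-columns the coupling forces `G = XS` with `S` skew-Hermitian; diagonalising `−iS` puts every
  recombined column in some `L(iω_c)`; the kernel columns are in `L(∞)`), Step 3
  `re_trace_mul_pos_of_orthogonal` (count `tr(Q·EEᴴ) = Σ colᴴ Q col`, invariant under the unitary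
  recombination).  This replaces the source's «unitary `U` with `UH^{1/2}E₀' = H^{1/2}E₁'` +
  eigenvectors of `U'`» (discrete time, then a Cayley transform §3.2.7) by a direct
  continuous-time alignment; the logical structure (separation ⇒ dual `H` ⇒ aligned columns ⇒
  `Σ eᵢ'Qeᵢ` sign contradiction) is the printed one.
* §3 **the theorem for real data**: `freq_pos_of_certificate` ((a) ⇒ (b)),
  `exists_certificate_of_freq_pos` ((b) ⇒ (a); the separation step is the tree's
  `Literature.Analysis.Convex.StrictLMIAlternative.exists_dual_of_not_exists_posDef`, B&V
  Example 5.14, applied to the symmetric pencil `P = Σ x_{ab}(E_{ab} + E_{ba})`; the dual `Z ⪰ 0`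
  is factored `Z = RᵀR` and its columns are fed to the core), **`strictKYP_iff`** (Megretski's
  (a) ⇔ (b) with real `P`), **`strictKYP_iff_resolvent`** (Rantzer's form: under
  `det(iωI − A) ≠ 0 ∀ ω` the frequency condition is `[(iωI − A)⁻¹B; I]ᴴ Q [(iωI − A)⁻¹B; I] ≻ 0`
  for all `ω` plus `Q₂₂ ≻ 0` at `ω = ∞`), **`strictKYP_neg_iff`** (the `≺ 0` version used for
  LMIs: `∃ P = Pᵀ, Q + [AᵀP + PA, PB; BᵀP, 0] ≺ 0` iff the form of `Q` is negative definite on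
  every `L(iω)` and on `L(∞)`).

## NOT typed

The non-strict version (Megretski `thm:kyplminsct` / Rantzer Thm 1 main clause: needs `(A, B)`
controllable; Megretski's proof goes through the optimal-control Theorem `thm:kypstabct`), the
complex-data theorem with complex Hermitian `P` (the separation tool in the tree,
`StrictLMIAlternative`, is typed over `ℝ`; the complex core §2 is ready for it), the
discrete-time versions (§1.1), the minimax theorems (§2), and the Riccati / stabilizing-solution
versions (`thm:kypstabct`).
-/

noncomputable section

open Matrix Finset Complex
open scoped BigOperators ComplexOrder ComplexConjugate

namespace Literature.Analysis.Matrix.KalmanYakubovichPopovLemma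

/-! ## §1 The KYP matrix `[AᵀP + PA, PB; BᵀP, 0]` and its basic identities

No definition is introduced: the matrix of the form `2 Re[xᴴP(Ax + Bu)]` is written explicitly as
the block matrix `Matrix.fromBlocks (Aᵀ * P + P * A) (P * B) (Bᵀ * P) 0` (real side) resp.
`Matrix.fromBlocks (Aᴴ * P + P * A) (P * B) (Bᴴ * P) 0` (complex side). -/

section RealSide

variable {R : Type*} [CommRing R]
variable {n m : Type*} [Fintype n]

/-- `P ↦ [AᵀP + PA, PB; BᵀP, 0]` is additive. [cite: Rantzer1996, Thm 1 (ii) (the map `P ↦ M + [AᵀP + PA, PB; BᵀP, 0]` is affine); Megretski2010, §1.2 (k15)] -/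
theorem kyp_add (A : Matrix n n R) (B : Matrix n m R) (P₁ P₂ : Matrix n n R) :
    fromBlocks (Aᵀ * (P₁ + P₂) + (P₁ + P₂) * A) ((P₁ + P₂) * B) (Bᵀ * (P₁ + P₂)) 0 =
      fromBlocks (Aᵀ * P₁ + P₁ * A) (P₁ * B) (Bᵀ * P₁) 0 +
        fromBlocks (Aᵀ * P₂ + P₂ * A) (P₂ * B) (Bᵀ * P₂) (0 : Matrix m m R) := by
  simp only [Matrix.mul_add, Matrix.add_mul, fromBlocks_add, add_zero]
  congr 1
  abel

/-- `P ↦ [AᵀP + PA, PB; BᵀP, 0]` is homogeneous. [cite: Rantzer1996, Thm 1 (ii); Megretski2010, §1.2 (k15)] -/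
theorem kyp_smul (A : Matrix n n R) (B : Matrix n m R) (c : R) (P : Matrix n n R) :
    fromBlocks (Aᵀ * (c • P) + (c • P) * A) ((c • P) * B) (Bᵀ * (c • P)) 0 =
      c • fromBlocks (Aᵀ * P + P * A) (P * B) (Bᵀ * P) (0 : Matrix m m R) := by
  simp only [Matrix.mul_smul, Matrix.smul_mul, fromBlocks_smul, smul_add, smul_zero]

/-- `P ↦ [AᵀP + PA, PB; BᵀP, 0]` commutes with finite sums.
[cite: Rantzer1996, Thm 1 (ii); Megretski2010, §1.2 (k15)] -/
theorem kyp_sum {ι : Type*} (s : Finset ι) (A : Matrix n n R) (B : Matrix n m R)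
    (P : ι → Matrix n n R) :
    fromBlocks (Aᵀ * (∑ i ∈ s, P i) + (∑ i ∈ s, P i) * A) ((∑ i ∈ s, P i) * B)
        (Bᵀ * (∑ i ∈ s, P i)) 0 =
      ∑ i ∈ s, fromBlocks (Aᵀ * P i + P i * A) (P i * B) (Bᵀ * P i) (0 : Matrix m m R) := by
  induction s using Finset.cons_induction with
  | empty => simp
  | cons a s ha ih => rw [sum_cons, sum_cons, kyp_add, ih]

/-- For symmetric `P` the matrix `[AᵀP + PA, PB; BᵀP, 0]` is symmetric.
[cite: Rantzer1996, Thm 1 (ii); Megretski2010, §1.2 (k15)] -/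
theorem kyp_transpose (A : Matrix n n R) (B : Matrix n m R) {P : Matrix n n R} (hP : Pᵀ = P) :
    (fromBlocks (Aᵀ * P + P * A) (P * B) (Bᵀ * P) (0 : Matrix m m R))ᵀ =
      fromBlocks (Aᵀ * P + P * A) (P * B) (Bᵀ * P) 0 := by
  simp only [fromBlocks_transpose, transpose_add, transpose_mul, transpose_transpose, hP,
    transpose_zero]
  congr 1
  exact add_comm _ _

/-- Trace of a block matrix. [folklore] -/
private theorem trace_fromBlocks' [Fintype m] (A : Matrix n n R) (B : Matrix n m R)
    (C : Matrix m n R) (D : Matrix m m R) :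
    (Matrix.fromBlocks A B C D).trace = A.trace + D.trace := by
  simp [Matrix.trace, Fintype.sum_sum_type]

/-- `tr([AᵀP + PA, PB; BᵀP, 0] · Z) = tr(P · (A Z₁₁ + Z₁₁ Aᵀ + B Z₂₁ + Z₁₂ Bᵀ))`: the adjoint of
`P ↦ [AᵀP + PA, PB; BᵀP, 0]` for the trace pairing (so «`tr(F_i Z) = 0` for all `i`» of the
LMI alternative reads `A Z₁₁ + Z₁₁ Aᵀ + B Z₂₁ + Z₁₂ Bᵀ = 0`). [cite: Megretski2010, §3.2.5 («`tr(H(E₀'PE₀ − E₁'PE₁)) = 0` for every `P = P'`, i.e. `E₀HE₀' = E₁HE₁'`», here in continuous time)] -/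
theorem trace_kyp_mul [Fintype m] (A : Matrix n n R) (B : Matrix n m R) (P : Matrix n n R)
    (Z : Matrix (n ⊕ m) (n ⊕ m) R) :
    trace (fromBlocks (Aᵀ * P + P * A) (P * B) (Bᵀ * P) 0 * Z) =
      trace (P * (A * Z.toBlocks₁₁ + Z.toBlocks₁₁ * Aᵀ + B * Z.toBlocks₂₁ + Z.toBlocks₁₂ * Bᵀ)) := by
  conv_lhs => rw [← fromBlocks_toBlocks Z]
  rw [fromBlocks_multiply, trace_fromBlocks']
  simp only [Matrix.add_mul, Matrix.zero_mul, add_zero, Matrix.mul_add, trace_add,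
    Matrix.mul_assoc]
  rw [trace_mul_comm Aᵀ, Matrix.mul_assoc, trace_mul_comm Bᵀ, Matrix.mul_assoc]
  abel

end RealSide

section ComplexSide

variable {R : Type*} [CommRing R] [StarRing R]
variable {n m : Type*} [Fintype n] [Fintype m]

/-- The Hermitian form of `[AᴴP + PA, PB; BᴴP, 0]`:
`(x;u)ᴴ [AᴴP + PA, PB; BᴴP, 0] (x;u) = (Ax + Bu)ᴴ P x + xᴴ P (Ax + Bu)` (= `2 Re[xᴴP(Ax+Bu)]`
for Hermitian `P`). [cite: Megretski2010, §1.2 (k15) («`σ_P(x,u) = σ(x,u) + 2Re[x'P(Ax+Bu)]`»)] -/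
theorem star_dotProduct_kyp_mulVec (A : Matrix n n R) (B : Matrix n m R) (P : Matrix n n R)
    (x : n → R) (u : m → R) :
    star (Sum.elim x u) ⬝ᵥ (fromBlocks (Aᴴ * P + P * A) (P * B) (Bᴴ * P) 0 *ᵥ Sum.elim x u) =
      star (A *ᵥ x + B *ᵥ u) ⬝ᵥ (P *ᵥ x) + star x ⬝ᵥ (P *ᵥ (A *ᵥ x + B *ᵥ u)) := by
  have hs : star (Sum.elim x u) = Sum.elim (star x) (star u) := by
    funext i
    cases i <;> rfl
  have h1 : star x ⬝ᵥ (Aᴴ *ᵥ (P *ᵥ x)) = star (A *ᵥ x) ⬝ᵥ (P *ᵥ x) := by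
    rw [dotProduct_mulVec, vecMul_conjTranspose, star_star]
  have h2 : star u ⬝ᵥ (Bᴴ *ᵥ (P *ᵥ x)) = star (B *ᵥ u) ⬝ᵥ (P *ᵥ x) := by
    rw [dotProduct_mulVec, vecMul_conjTranspose, star_star]
  rw [hs, fromBlocks_mulVec, Sum.elim_comp_inl, Sum.elim_comp_inr, sumElim_dotProduct_sumElim]
  simp only [zero_mulVec, add_zero, add_mulVec, ← mulVec_mulVec, dotProduct_add, h1, h2,
    star_add, add_dotProduct, mulVec_add]
  abel

end ComplexSide

section RealToComplex

variable {n m : Type*} [Fintype n]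

/-- Real data embed into `ℂ`: `[AᵀP + PA, PB; BᵀP, 0].map ofReal = [A_ℂᴴP_ℂ + P_ℂA_ℂ, P_ℂB_ℂ; B_ℂᴴP_ℂ, 0]`.
[cite: Megretski2010, §1.2 («when matrices `A, B, Q` are real …»)] -/
theorem kyp_map_ofReal (A : Matrix n n ℝ) (B : Matrix n m ℝ) (P : Matrix n n ℝ) :
    (fromBlocks (Aᵀ * P + P * A) (P * B) (Bᵀ * P) (0 : Matrix m m ℝ)).map Complex.ofRealHom =
      fromBlocks ((A.map Complex.ofRealHom)ᴴ * P.map Complex.ofRealHom +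
          P.map Complex.ofRealHom * A.map Complex.ofRealHom)
        (P.map Complex.ofRealHom * B.map Complex.ofRealHom)
        ((B.map Complex.ofRealHom)ᴴ * P.map Complex.ofRealHom) 0 := by
  have hc : ∀ M : Matrix n n ℝ, (Mᵀ).map Complex.ofRealHom = (M.map Complex.ofRealHom)ᴴ :=
    fun M => by
      rw [← conjTranspose_eq_transpose_of_trivial]
      exact Matrix.conjTranspose_map _ (fun a => by simp)
  have hc' : ∀ M : Matrix n m ℝ, (Mᵀ).map Complex.ofRealHom = (M.map Complex.ofRealHom)ᴴ :=
    fun M => by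
      rw [← conjTranspose_eq_transpose_of_trivial]
      exact Matrix.conjTranspose_map _ (fun a => by simp)
  simp only [fromBlocks_map, Matrix.map_add _ (map_add Complex.ofRealHom), Matrix.map_mul, hc,
    hc', Matrix.map_zero _ (map_zero Complex.ofRealHom)]

end RealToComplex

/-! ## §2 The complex core: a dual matrix produces a violating frequency point

Throughout, `E : Matrix (n ⊕ m) r ℂ` is a family of `r` vectors `(x_k; u_k) ∈ ℂⁿ × ℂᵐ` (its
columns), `X = E.toRows₁` the `x`-parts, `Y = E.toRows₂` the `u`-parts, `G = AX + BY` the family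
`g_k = Ax_k + Bu_k`, and `E Eᴴ = Σ_k (x_k;u_k)(x_k;u_k)ᴴ` the matrix `H` of the dual.  -/

section Core

variable {n m r : Type*} [Fintype n] [Fintype m] [Fintype r]

omit [Fintype n] [Fintype m] in
/-- `tr(Q · E Eᴴ) = Σ_k (col_k E)ᴴ Q (col_k E)`.
[cite: Megretski2010, §3.2.5 («`0 ≥ tr(QH) = tr(Q Σ eᵢeᵢ') = Σ eᵢ'Qeᵢ`»)] -/
theorem trace_mul_mul_conjTranspose {p : Type*} [Fintype p] (Q : Matrix p p ℂ)
    (E : Matrix p r ℂ) :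
    trace (Q * (E * Eᴴ)) = ∑ k, star (Eᵀ k) ⬝ᵥ (Q *ᵥ Eᵀ k) := by
  rw [← Matrix.mul_assoc, trace_mul_comm]
  simp only [trace, diag_apply, mul_apply, conjTranspose_apply, dotProduct, mulVec,
    transpose_apply, Pi.star_apply]

omit [Fintype n] [Fintype m] [Fintype r] in
/-- Column `k` of a product: `M (Nᵀ k) = (MN)ᵀ k`. [folklore] -/
private theorem mulVec_transpose_apply {p q : Type*} [Fintype q] (M : Matrix p q ℂ)
    (N : Matrix q r ℂ) (k : r) : M *ᵥ (Nᵀ k) = (M * N)ᵀ k := by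
  funext i
  simp [mulVec, dotProduct, mul_apply]

omit [Fintype n] [Fintype m] in
/-- Column `k` of `M · diagonal d` is `d k • (col_k M)`. [folklore] -/
private theorem transpose_mul_diagonal_apply [DecidableEq r] {p : Type*} (M : Matrix p r ℂ)
    (d : r → ℂ) (k : r) : (M * diagonal d)ᵀ k = d k • Mᵀ k := by
  funext i
  simp [mul_diagonal, mul_comm]

omit [Fintype n] [Fintype m] [Fintype r] in
/-- A column of `E` is the stack of the corresponding columns of `E.toRows₁` and `E.toRows₂`.
[folklore] -/
private theorem transpose_apply_eq_sum_elim {p q : Type*} (E : Matrix (p ⊕ q) r ℂ) (k : r) :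
    Eᵀ k = Sum.elim (E.toRows₁ᵀ k) (E.toRows₂ᵀ k) := by
  funext i
  cases i <;> rfl

omit [Fintype n] [Fintype m] [Fintype r] in
/-- `(Xᴴ X)_{kk} = 0` iff column `k` of `X` vanishes. [folklore] -/
private theorem conjTranspose_mul_self_apply_eq_zero_iff {p : Type*} [Fintype p]
    (X : Matrix p r ℂ) (k : r) : (Xᴴ * X) k k = 0 ↔ Xᵀ k = 0 := by
  have : (Xᴴ * X) k k = star (Xᵀ k) ⬝ᵥ Xᵀ k := by
    simp [mul_apply, dotProduct, conjTranspose_apply, transpose_apply]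
  rw [this, dotProduct_star_self_eq_zero]

omit [Fintype n] [Fintype m] in
/-- **Step 1 (orthogonalise the `x`-parts).** For every `X : ℂ^{p×r}` there is a unitary `U` with
the columns of `XU` pairwise orthogonal (`U` = an eigenvector matrix of the Gram matrix `XᴴX`).
[cite: Megretski2010, §3.2.5 (first step of the alignment: spectral decomposition)] -/
theorem exists_unitary_cols_orthogonal [DecidableEq r] {p : Type*} [Fintype p]
    (X : Matrix p r ℂ) :
    ∃ U : Matrix r r ℂ, U * Uᴴ = 1 ∧ Uᴴ * U = 1 ∧
      ∀ a b, a ≠ b → ((X * U)ᴴ * (X * U)) a b = 0 := by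
  have hΓ : (Xᴴ * X).IsHermitian := isHermitian_conjTranspose_mul_self X
  refine ⟨(hΓ.eigenvectorUnitary : Matrix r r ℂ), ?_, ?_, fun a b hab => ?_⟩
  · simpa [Matrix.star_eq_conjTranspose] using
      Matrix.mem_unitaryGroup_iff.mp hΓ.eigenvectorUnitary.2
  · simpa [Matrix.star_eq_conjTranspose] using
      Matrix.mem_unitaryGroup_iff'.mp hΓ.eigenvectorUnitary.2
  · have h := hΓ.conjStarAlgAut_star_eigenvectorUnitary
    rw [Unitary.conjStarAlgAut_star_apply, Matrix.star_eq_conjTranspose] at h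
    rw [conjTranspose_mul, Matrix.mul_assoc, ← Matrix.mul_assoc Xᴴ, ← Matrix.mul_assoc, h,
      diagonal_apply_ne _ hab]


omit [Fintype n] [Fintype m] [Fintype r] in
/-- Selecting columns commutes with left multiplication. [folklore] -/
private theorem mul_submatrix_cols {p q T : Type*} [Fintype q] (M : Matrix p q ℂ)
    (N : Matrix q r ℂ) (f : T → r) : M * N.submatrix id f = (M * N).submatrix id f := by
  ext i j
  simp [mul_apply]

omit [Fintype m] [Fintype r] in
/-- Selecting columns, then taking `ᴴ` and multiplying = selecting rows of `Nᴴ D`. [folklore] -/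
private theorem conjTranspose_submatrix_mul {T T' : Type*} (N : Matrix n r ℂ) (f : T → r)
    (D : Matrix n T' ℂ) : (N.submatrix id f)ᴴ * D = (Nᴴ * D).submatrix f id := by
  ext a b
  simp [mul_apply]

omit [Fintype m] in
/-- **Step 2 (align).** Let the columns of `X : ℂ^{n×r}` be pairwise orthogonal and let
`G : ℂ^{n×r}` satisfy the coupling `G Xᴴ + X Gᴴ = 0`.  On the support `T = {k : x_k ≠ 0}` one has
`G_T = X_T S` with `S` skew-Hermitian, so after the unitary recombination `W` diagonalising the
Hermitian matrix `−iS` every column is ALIGNED: `g'_c = iω_c x'_c` with `ω_c ∈ ℝ`, i.e.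
`(x'_c, u'_c) ∈ L(iω_c)`.  (Continuous-time counterpart of the step «`E₀H^{1/2}U' = E₁H^{1/2}` …
let `wᵢ` be an orthonormal basis of eigenvectors of `U'` … by construction `(xᵢ, uᵢ) ∈ L(zᵢ)`»;
here only Hermitian spectral theorems are used.)
[cite: Megretski2010, §3.2.5 (alignment step) with §3.2.7 (continuous time)] -/
theorem exists_unitary_align [DecidableEq r] {X G : Matrix n r ℂ}
    (horth : ∀ a b, a ≠ b → (Xᴴ * X) a b = 0) (hc : G * Xᴴ + X * Gᴴ = 0) :
    ∃ (W : Matrix {k : r // (Xᴴ * X) k k ≠ 0} {k : r // (Xᴴ * X) k k ≠ 0} ℂ)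
      (ω : {k : r // (Xᴴ * X) k k ≠ 0} → ℝ), W * Wᴴ = 1 ∧ Wᴴ * W = 1 ∧
      (G.submatrix id Subtype.val : Matrix n {k : r // (Xᴴ * X) k k ≠ 0} ℂ) * W =
        (X.submatrix id Subtype.val : Matrix n {k : r // (Xᴴ * X) k k ≠ 0} ℂ) * W *
          diagonal (fun c => ((ω c : ℝ) : ℂ) * I) := by
  -- (0) bookkeeping
  have hKreal : ∀ a : r, star ((Xᴴ * X) a a) = (Xᴴ * X) a a := fun a => by
    have h := congrFun (congrFun (isHermitian_conjTranspose_mul_self X) a) a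
    rwa [conjTranspose_apply] at h
  have hLstar : ∀ a b : r, star ((Xᴴ * G) b a) = (Gᴴ * X) a b := fun a b => by
    rw [← conjTranspose_apply (Xᴴ * G) b a, conjTranspose_mul, conjTranspose_conjTranspose]
  have hX0 : ∀ k : r, (Xᴴ * X) k k = 0 → ∀ i, X i k = 0 := fun k hk i => by
    have h := (conjTranspose_mul_self_apply_eq_zero_iff X k).mp hk
    exact congrFun h i
  -- (1) Claim 1: `(XᴴG)_{ab} (XᴴX)_{bb} + (XᴴX)_{aa} (GᴴX)_{ab} = 0`
  have hc1 : ∀ a b : r,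
      (Xᴴ * G) a b * (Xᴴ * X) b b + (Xᴴ * X) a a * (Gᴴ * X) a b = 0 := by
    intro a b
    have h0 : Xᴴ * (G * Xᴴ + X * Gᴴ) * X = 0 := by rw [hc, Matrix.mul_zero, Matrix.zero_mul]
    have e : Xᴴ * (G * Xᴴ + X * Gᴴ) * X = Xᴴ * G * (Xᴴ * X) + Xᴴ * X * (Gᴴ * X) := by
      simp only [Matrix.mul_add, Matrix.add_mul, Matrix.mul_assoc]
    have e1 : (Xᴴ * G * (Xᴴ * X)) a b = (Xᴴ * G) a b * (Xᴴ * X) b b := by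
      rw [Matrix.mul_apply]
      exact Finset.sum_eq_single_of_mem b (Finset.mem_univ b)
        (fun k _ hkb => by rw [horth k b hkb, mul_zero])
    have e2 : (Xᴴ * X * (Gᴴ * X)) a b = (Xᴴ * X) a a * (Gᴴ * X) a b := by
      rw [Matrix.mul_apply]
      exact Finset.sum_eq_single_of_mem a (Finset.mem_univ a)
        (fun k _ hka => by rw [horth a k (Ne.symm hka), zero_mul])
    have h1 := congrFun (congrFun h0 a) b
    rw [e, Matrix.add_apply, e1, e2] at h1
    exact h1
  -- (2) the coefficient matrix `S` on the support and its skew-Hermitian property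
  set S : Matrix {k : r // (Xᴴ * X) k k ≠ 0} {k : r // (Xᴴ * X) k k ≠ 0} ℂ :=
    Matrix.of fun a b => ((Xᴴ * X) a.1 a.1)⁻¹ * (Xᴴ * G) a.1 b.1 with hSdef
  have hSapply : ∀ a b : {k : r // (Xᴴ * X) k k ≠ 0},
      S a b = ((Xᴴ * X) a.1 a.1)⁻¹ * (Xᴴ * G) a.1 b.1 := fun a b => by
    rw [hSdef, Matrix.of_apply]
  have hS : Sᴴ = -S := by
    ext a b
    rw [conjTranspose_apply, Matrix.neg_apply, hSapply, hSapply, star_mul', star_inv₀, hKreal,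
      hLstar]
    have ha := a.2
    have hb := b.2
    have h := hc1 a.1 b.1
    field_simp
    linear_combination h
  -- (3) Claim 3: `G_T = X_T S`
  set XT : Matrix n {k : r // (Xᴴ * X) k k ≠ 0} ℂ := X.submatrix id Subtype.val with hXT
  set GT : Matrix n {k : r // (Xᴴ * X) k k ≠ 0} ℂ := G.submatrix id Subtype.val with hGT
  have hXD : Xᴴ * (GT - XT * S) = 0 := by
    ext k b
    have hA : (Xᴴ * GT) k b = (Xᴴ * G) k b.1 := by
      rw [hGT, mul_submatrix_cols]
      rfl
    have hB : (Xᴴ * (XT * S)) k b = ∑ a, (Xᴴ * X) k a.1 * S a b := by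
      rw [← Matrix.mul_assoc, Matrix.mul_apply]
      simp only [hXT, mul_submatrix_cols, submatrix_apply, id_eq]
    rw [Matrix.mul_sub, Matrix.sub_apply, Matrix.zero_apply, hA, hB]
    by_cases hk : (Xᴴ * X) k k = 0
    · have hrow : (Xᴴ * G) k b.1 = 0 := by
        simp [Matrix.mul_apply, conjTranspose_apply, hX0 k hk]
      have hrow' : ∀ a : {k : r // (Xᴴ * X) k k ≠ 0}, (Xᴴ * X) k a.1 = 0 := fun a =>
        horth k a.1 (fun h => by subst h; exact a.2 hk)
      rw [hrow, Finset.sum_eq_zero (fun a _ => by rw [hrow' a, zero_mul]), sub_zero]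
    · rw [Finset.sum_eq_single_of_mem (⟨k, hk⟩ : {k : r // (Xᴴ * X) k k ≠ 0})
        (Finset.mem_univ _) (fun a _ ha => ?_)]
      · have h := hSapply ⟨k, hk⟩ b
        dsimp only at h
        rw [h, ← mul_assoc, mul_inv_cancel₀ hk, one_mul, sub_self]
      · have hak : k ≠ a.1 := fun h => ha (Subtype.ext h.symm)
        rw [horth k a.1 hak, zero_mul]
  have hXTD : XTᴴ * (GT - XT * S) = 0 := by
    have h := congrArg (fun M : Matrix r {k : r // (Xᴴ * X) k k ≠ 0} ℂ =>
      M.submatrix (Subtype.val : {k : r // (Xᴴ * X) k k ≠ 0} → r) id) hXD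
    simp only [submatrix_zero, Pi.zero_apply] at h
    rw [← conjTranspose_submatrix_mul, ← hXT] at h
    exact h
  have hGD : GTᴴ * (GT - XT * S) = 0 := by
    have h1 : X * (Gᴴ * (GT - XT * S)) = 0 := by
      have h := congrArg (· * (GT - XT * S)) hc
      simpa only [Matrix.add_mul, Matrix.mul_assoc, hXD, Matrix.mul_zero, zero_add,
        Matrix.zero_mul] using h
    have h2 : Xᴴ * X * (Gᴴ * (GT - XT * S)) = 0 := by
      rw [Matrix.mul_assoc, h1, Matrix.mul_zero]
    have h4 : ∀ (a b : {k : r // (Xᴴ * X) k k ≠ 0}), (Gᴴ * (GT - XT * S)) a.1 b = 0 := by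
      intro a b
      have h3 := congrFun (congrFun h2 a.1) b
      rw [Matrix.mul_apply, Matrix.zero_apply, Finset.sum_eq_single_of_mem a.1 (Finset.mem_univ _)
        (fun k _ hka => by rw [horth a.1 k (Ne.symm hka), zero_mul])] at h3
      exact (mul_eq_zero.mp h3).resolve_left a.2
    have h6 : GTᴴ * (GT - XT * S) =
        (Gᴴ * (GT - XT * S)).submatrix (Subtype.val : {k : r // (Xᴴ * X) k k ≠ 0} → r) id := by
      rw [hGT]
      exact conjTranspose_submatrix_mul G Subtype.val _
    rw [h6]
    ext a b
    exact h4 a b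
  have hD : GT - XT * S = 0 := by
    rw [← conjTranspose_mul_self_eq_zero]
    rw [conjTranspose_sub, conjTranspose_mul, Matrix.sub_mul, Matrix.mul_assoc, hGD, hXTD,
      Matrix.mul_zero, sub_zero]
  have hGTeq : GT = XT * S := sub_eq_zero.mp hD
  -- (4) diagonalise the Hermitian matrix `H = -i S`
  set H : Matrix {k : r // (Xᴴ * X) k k ≠ 0} {k : r // (Xᴴ * X) k k ≠ 0} ℂ := (-I) • S with hH
  have hHherm : H.IsHermitian := by
    show Hᴴ = H
    rw [hH, conjTranspose_smul, hS]
    simp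
  set W : Matrix {k : r // (Xᴴ * X) k k ≠ 0} {k : r // (Xᴴ * X) k k ≠ 0} ℂ :=
    (hHherm.eigenvectorUnitary : Matrix {k : r // (Xᴴ * X) k k ≠ 0} {k : r // (Xᴴ * X) k k ≠ 0} ℂ)
    with hWdef
  have hW1 : W * Wᴴ = 1 := by
    have h := Matrix.mem_unitaryGroup_iff.mp hHherm.eigenvectorUnitary.2
    rw [Matrix.star_eq_conjTranspose, ← hWdef] at h
    exact h
  have hW2 : Wᴴ * W = 1 := by
    have h := Matrix.mem_unitaryGroup_iff'.mp hHherm.eigenvectorUnitary.2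
    rw [Matrix.star_eq_conjTranspose, ← hWdef] at h
    exact h
  have hHW : Wᴴ * H * W = diagonal (RCLike.ofReal ∘ hHherm.eigenvalues) := by
    have h := hHherm.conjStarAlgAut_star_eigenvectorUnitary
    rw [Unitary.conjStarAlgAut_star_apply, Matrix.star_eq_conjTranspose, ← hWdef] at h
    exact h
  refine ⟨W, hHherm.eigenvalues, hW1, hW2, ?_⟩
  have hHW' : H * W = W * diagonal (RCLike.ofReal ∘ hHherm.eigenvalues) := by
    rw [← hHW, ← Matrix.mul_assoc, ← Matrix.mul_assoc, hW1, Matrix.one_mul]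
  have hSI : S = I • H := by
    rw [hH, smul_smul, show I * -I = (1 : ℂ) by rw [mul_neg, I_mul_I, neg_neg], one_smul]
  have hSW : S * W = W * diagonal (fun c => ((hHherm.eigenvalues c : ℝ) : ℂ) * I) := by
    rw [hSI, Matrix.smul_mul, hHW', ← Matrix.mul_smul]
    congr 1
    ext a b
    by_cases hab : a = b
    · subst hab
      simp only [Matrix.smul_apply, diagonal_apply_eq, Function.comp_apply, smul_eq_mul]
      exact mul_comm _ _
    · simp only [Matrix.smul_apply, diagonal_apply_ne _ hab, smul_zero]
  rw [hGTeq, Matrix.mul_assoc, hSW, ← Matrix.mul_assoc]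


omit [Fintype n] [Fintype m] [Fintype r] in
/-- Rows `₁` of a column-selected product. [folklore] -/
private theorem toRows₁_submatrix_mul {p q T : Type*} [Fintype T] (E : Matrix (p ⊕ q) r ℂ)
    (f : T → r) (W : Matrix T T ℂ) :
    (E.submatrix id f * W).toRows₁ = E.toRows₁.submatrix id f * W := by
  ext i j
  rfl

omit [Fintype n] [Fintype m] [Fintype r] in
/-- Rows `₂` of a column-selected product. [folklore] -/
private theorem toRows₂_submatrix_mul {p q T : Type*} [Fintype T] (E : Matrix (p ⊕ q) r ℂ)
    (f : T → r) (W : Matrix T T ℂ) :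
    (E.submatrix id f * W).toRows₂ = E.toRows₂.submatrix id f * W := by
  ext i j
  rfl

/-- **Step 3 (count), orthogonal case.** If the `x`-columns of `E` are pairwise orthogonal, the
coupling `GXᴴ + XGᴴ = 0` holds and the Hermitian form of `Q` is positive definite on every
`L(iω)` and on `L(∞)`, then `Re tr(Q · EEᴴ) > 0` unless `E = 0`: after the alignment of Step 2
every column lies in some `L(iω_c)` (support) or in `L(∞)` (kernel columns), and
`tr(Q · EEᴴ) = Σ (col)ᴴ Q (col)` is invariant under the unitary recombination.
[cite: Megretski2010, §3.2.5 («by assumption (b) `eᵢ'Qeᵢ > 0` whenever `eᵢ ≠ 0` … hence `eᵢ = 0` for all `i` and therefore `H = 0`»)] -/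
private theorem re_trace_mul_pos_of_orthogonal [DecidableEq r] (A : Matrix n n ℂ)
    (B : Matrix n m ℂ) (Q : Matrix (n ⊕ m) (n ⊕ m) ℂ)
    (hfreq : ∀ (ω : ℝ) (x : n → ℂ) (u : m → ℂ), A *ᵥ x + B *ᵥ u = ((ω : ℂ) * I) • x →
      Sum.elim x u ≠ 0 → 0 < (star (Sum.elim x u) ⬝ᵥ (Q *ᵥ Sum.elim x u)).re)
    (hinf : ∀ u : m → ℂ, u ≠ 0 →
      0 < (star (Sum.elim (0 : n → ℂ) u) ⬝ᵥ (Q *ᵥ Sum.elim 0 u)).re)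
    {E : Matrix (n ⊕ m) r ℂ} (horth : ∀ a b, a ≠ b → (E.toRows₁ᴴ * E.toRows₁) a b = 0)
    (hc : (A * E.toRows₁ + B * E.toRows₂) * E.toRows₁ᴴ +
      E.toRows₁ * (A * E.toRows₁ + B * E.toRows₂)ᴴ = 0)
    (hE : E ≠ 0) : 0 < (trace (Q * (E * Eᴴ))).re := by
  -- the two per-column dichotomies
  have key1 : ∀ (ω : ℝ) (x : n → ℂ) (u : m → ℂ), A *ᵥ x + B *ᵥ u = ((ω : ℂ) * I) • x →
      0 ≤ (star (Sum.elim x u) ⬝ᵥ (Q *ᵥ Sum.elim x u)).re ∧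
        ((star (Sum.elim x u) ⬝ᵥ (Q *ᵥ Sum.elim x u)).re = 0 → Sum.elim x u = 0) := by
    intro ω x u hxu
    by_cases h0 : Sum.elim x u = 0
    · rw [h0]
      simp
    · have hpos := hfreq ω x u hxu h0
      exact ⟨hpos.le, fun h => absurd h hpos.ne'⟩
  have key2 : ∀ u : m → ℂ,
      0 ≤ (star (Sum.elim (0 : n → ℂ) u) ⬝ᵥ (Q *ᵥ Sum.elim 0 u)).re ∧
        ((star (Sum.elim (0 : n → ℂ) u) ⬝ᵥ (Q *ᵥ Sum.elim 0 u)).re = 0 →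
          Sum.elim (0 : n → ℂ) u = 0) := by
    intro u
    by_cases h0 : u = 0
    · subst h0
      have : Sum.elim (0 : n → ℂ) (0 : m → ℂ) = 0 := by
        funext i
        cases i <;> rfl
      rw [this]
      simp
    · have hpos := hinf u h0
      exact ⟨hpos.le, fun h => absurd h hpos.ne'⟩
  -- align the support columns
  obtain ⟨W, ω, hW1, -, halign⟩ := exists_unitary_align horth hc
  set ET : Matrix (n ⊕ m) {k : r // (E.toRows₁ᴴ * E.toRows₁) k k ≠ 0} ℂ :=
    E.submatrix id Subtype.val with hET
  set XT : Matrix n {k : r // (E.toRows₁ᴴ * E.toRows₁) k k ≠ 0} ℂ :=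
    E.toRows₁.submatrix id Subtype.val with hXT
  set YT : Matrix m {k : r // (E.toRows₁ᴴ * E.toRows₁) k k ≠ 0} ℂ :=
    E.toRows₂.submatrix id Subtype.val with hYT
  have hGT : (A * E.toRows₁ + B * E.toRows₂).submatrix id Subtype.val = A * XT + B * YT := by
    rw [hXT, hYT, mul_submatrix_cols, mul_submatrix_cols]
    ext i j
    rfl
  -- every recombined support column lies in `L(iω_c)`
  have hcol : ∀ c, A *ᵥ ((XT * W)ᵀ c) + B *ᵥ ((YT * W)ᵀ c) =
      (((ω c : ℝ) : ℂ) * I) • ((XT * W)ᵀ c) := by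
    intro c
    calc A *ᵥ ((XT * W)ᵀ c) + B *ᵥ ((YT * W)ᵀ c) = ((A * XT + B * YT) * W)ᵀ c := by
          rw [mulVec_transpose_apply, mulVec_transpose_apply, Matrix.add_mul, transpose_add,
            Matrix.mul_assoc, Matrix.mul_assoc]
          rfl
      _ = (XT * W * diagonal (fun c => ((ω c : ℝ) : ℂ) * I))ᵀ c := by rw [← hGT, halign]
      _ = _ := transpose_mul_diagonal_apply _ _ c
  have hT : ∀ c, 0 ≤ (star ((ET * W)ᵀ c) ⬝ᵥ (Q *ᵥ (ET * W)ᵀ c)).re ∧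
      ((star ((ET * W)ᵀ c) ⬝ᵥ (Q *ᵥ (ET * W)ᵀ c)).re = 0 → (ET * W)ᵀ c = 0) := by
    intro c
    rw [transpose_apply_eq_sum_elim (ET * W) c, hET, toRows₁_submatrix_mul, toRows₂_submatrix_mul]
    exact key1 (ω c) _ _ (hcol c)
  -- kernel columns lie in `L(∞)`
  have hTc : ∀ k : {k : r // ¬ (E.toRows₁ᴴ * E.toRows₁) k k ≠ 0},
      0 ≤ (star (Eᵀ k.1) ⬝ᵥ (Q *ᵥ Eᵀ k.1)).re ∧
        ((star (Eᵀ k.1) ⬝ᵥ (Q *ᵥ Eᵀ k.1)).re = 0 → Eᵀ k.1 = 0) := by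
    intro k
    have hx : E.toRows₁ᵀ k.1 = 0 :=
      (conjTranspose_mul_self_apply_eq_zero_iff E.toRows₁ k.1).mp (not_not.mp k.2)
    rw [transpose_apply_eq_sum_elim E k.1, hx]
    exact key2 _
  -- `tr(Q·EEᴴ)` splits into the support part (recombined by `W`) and the kernel part
  have h1 : ∑ b : {k : r // (E.toRows₁ᴴ * E.toRows₁) k k ≠ 0}, star (Eᵀ b.1) ⬝ᵥ (Q *ᵥ Eᵀ b.1)
      = trace (Q * (ET * ETᴴ)) := by
    rw [trace_mul_mul_conjTranspose]
    rfl
  have h2 : ET * ETᴴ = (ET * W) * (ET * W)ᴴ := by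
    rw [conjTranspose_mul, Matrix.mul_assoc, ← Matrix.mul_assoc W, hW1, Matrix.one_mul]
  have hsplitC : trace (Q * (E * Eᴴ)) =
      (∑ c, star ((ET * W)ᵀ c) ⬝ᵥ (Q *ᵥ (ET * W)ᵀ c)) +
        ∑ k : {k : r // ¬ (E.toRows₁ᴴ * E.toRows₁) k k ≠ 0}, star (Eᵀ k.1) ⬝ᵥ (Q *ᵥ Eᵀ k.1) := by
    rw [trace_mul_mul_conjTranspose Q E,
      ← Fintype.sum_subtype_add_sum_subtype (fun k => (E.toRows₁ᴴ * E.toRows₁) k k ≠ 0)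
        (fun k => star (Eᵀ k) ⬝ᵥ (Q *ᵥ Eᵀ k))]
    congr 1
    rw [h1, h2, trace_mul_mul_conjTranspose]
  have hsplit := congrArg Complex.re hsplitC
  rw [Complex.add_re, Complex.re_sum, Complex.re_sum] at hsplit
  rw [hsplit]
  have hS1 : 0 ≤ ∑ c, (star ((ET * W)ᵀ c) ⬝ᵥ (Q *ᵥ (ET * W)ᵀ c)).re :=
    Finset.sum_nonneg fun c _ => (hT c).1
  have hS2 : 0 ≤ ∑ k : {k : r // ¬ (E.toRows₁ᴴ * E.toRows₁) k k ≠ 0},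
      (star (Eᵀ k.1) ⬝ᵥ (Q *ᵥ Eᵀ k.1)).re :=
    Finset.sum_nonneg fun k _ => (hTc k).1
  by_contra hneg
  have hS1z : ∑ c, (star ((ET * W)ᵀ c) ⬝ᵥ (Q *ᵥ (ET * W)ᵀ c)).re = 0 := by linarith
  have hS2z : ∑ k : {k : r // ¬ (E.toRows₁ᴴ * E.toRows₁) k k ≠ 0},
      (star (Eᵀ k.1) ⬝ᵥ (Q *ᵥ Eᵀ k.1)).re = 0 := by linarith
  have hcols1 : ∀ c, (ET * W)ᵀ c = 0 := fun c =>
    (hT c).2 ((Finset.sum_eq_zero_iff_of_nonneg (fun c _ => (hT c).1)).mp hS1z c (mem_univ c))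
  have hcols2 : ∀ k : {k : r // ¬ (E.toRows₁ᴴ * E.toRows₁) k k ≠ 0}, Eᵀ k.1 = 0 := fun k =>
    (hTc k).2 ((Finset.sum_eq_zero_iff_of_nonneg (fun k _ => (hTc k).1)).mp hS2z k (mem_univ k))
  have hETW : ET * W = 0 := by
    ext i c
    exact congrFun (hcols1 c) i
  have hET0 : ET = 0 := by
    rw [← Matrix.mul_one ET, ← hW1, ← Matrix.mul_assoc, hETW, Matrix.zero_mul]
  apply hE
  ext i k
  by_cases hk : (E.toRows₁ᴴ * E.toRows₁) k k ≠ 0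
  · exact congrFun (congrFun hET0 i) ⟨k, hk⟩
  · exact congrFun (hcols2 ⟨k, hk⟩) i

omit [Fintype n] [Fintype m] [Fintype r] in
/-- Rows `₁` of a product. [folklore] -/
private theorem toRows₁_mul {p q T : Type*} [Fintype T] (E : Matrix (p ⊕ q) T ℂ)
    (U : Matrix T r ℂ) : (E * U).toRows₁ = E.toRows₁ * U := by
  ext i j
  rfl

omit [Fintype n] [Fintype m] [Fintype r] in
/-- Rows `₂` of a product. [folklore] -/
private theorem toRows₂_mul {p q T : Type*} [Fintype T] (E : Matrix (p ⊕ q) T ℂ)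
    (U : Matrix T r ℂ) : (E * U).toRows₂ = E.toRows₂ * U := by
  ext i j
  rfl

/-- **The complex core of the strict KYP lemma (dual matrix ⇒ violating frequency point).**
Let `A ∈ ℂ^{n×n}`, `B ∈ ℂ^{n×m}`, `Q ∈ ℂ^{(n+m)×(n+m)}`, and suppose the Hermitian form
`v ↦ Re(vᴴQv)` is positive definite on every subspace `L(iω) = {(x, u) : iωx = Ax + Bu}`
(`ω ∈ ℝ`) and on `L(∞) = {0} × ℂᵐ` (condition (b) of the strict CT theorem).  Then for every
family of vectors `E = ((x_k; u_k))_k` (columns) satisfying the COUPLING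
`(AX + BY)Xᴴ + X(AX + BY)ᴴ = 0` (`X`, `Y` = the `x`- and `u`-rows of `E`; for `H = EEᴴ` this is the
continuous-time form `AH₁₁ + H₁₁Aᴴ + BH₂₁ + H₁₂Bᴴ = 0` of «`E₀HE₀' = E₁HE₁'`») one has
`Re tr(Q · EEᴴ) > 0` unless `E = 0`.  Equivalently: a nonzero `H = EEᴴ ⪰ 0` with the coupling
and `Re tr(QH) ≤ 0` — the dual object produced by Hahn–Banach when no `P` exists — contradicts
(b).  Proof: orthogonalise the `x`-columns (Step 1), align (Step 2), count (Step 3).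
[cite: Megretski2010, §1.2 strict-LMI CT theorem (label `thm:kyplmisct`) with proof §3.2.5 («there exists `H = H' ≠ 0` … `tr(QH) ≤ 0` … `H ≥ 0` … `E₀HE₀' = E₁HE₁'` … by construction `(xᵢ, uᵢ) ∈ L(zᵢ)` … Hence `eᵢ = 0` for all `i` and therefore `H = 0`, which contradicts the construction») and §3.2.7 (CT from DT)] -/
theorem re_trace_mul_pos_of_coupling [DecidableEq r] (A : Matrix n n ℂ) (B : Matrix n m ℂ)
    (Q : Matrix (n ⊕ m) (n ⊕ m) ℂ)
    (hfreq : ∀ (ω : ℝ) (x : n → ℂ) (u : m → ℂ), A *ᵥ x + B *ᵥ u = ((ω : ℂ) * I) • x →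
      Sum.elim x u ≠ 0 → 0 < (star (Sum.elim x u) ⬝ᵥ (Q *ᵥ Sum.elim x u)).re)
    (hinf : ∀ u : m → ℂ, u ≠ 0 →
      0 < (star (Sum.elim (0 : n → ℂ) u) ⬝ᵥ (Q *ᵥ Sum.elim 0 u)).re)
    {E : Matrix (n ⊕ m) r ℂ}
    (hc : (A * E.toRows₁ + B * E.toRows₂) * E.toRows₁ᴴ +
      E.toRows₁ * (A * E.toRows₁ + B * E.toRows₂)ᴴ = 0)
    (hE : E ≠ 0) : 0 < (trace (Q * (E * Eᴴ))).re := by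
  obtain ⟨U, hU1, -, horth⟩ := exists_unitary_cols_orthogonal E.toRows₁
  have hc' : (A * (E * U).toRows₁ + B * (E * U).toRows₂) * (E * U).toRows₁ᴴ +
      (E * U).toRows₁ * (A * (E * U).toRows₁ + B * (E * U).toRows₂)ᴴ = 0 := by
    rw [toRows₁_mul, toRows₂_mul]
    have e : A * (E.toRows₁ * U) + B * (E.toRows₂ * U) = (A * E.toRows₁ + B * E.toRows₂) * U := by
      rw [Matrix.add_mul, Matrix.mul_assoc, Matrix.mul_assoc]
    rw [e, conjTranspose_mul, conjTranspose_mul, Matrix.mul_assoc, ← Matrix.mul_assoc U, hU1,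
      Matrix.one_mul, Matrix.mul_assoc, ← Matrix.mul_assoc U, hU1, Matrix.one_mul, hc]
  have hE' : E * U ≠ 0 := fun h => hE (by
    rw [← Matrix.mul_one E, ← hU1, ← Matrix.mul_assoc, h, Matrix.zero_mul])
  have horth' : ∀ a b, a ≠ b → ((E * U).toRows₁ᴴ * (E * U).toRows₁) a b = 0 := by
    rw [toRows₁_mul]
    exact horth
  have h := re_trace_mul_pos_of_orthogonal A B Q hfreq hinf horth' hc' hE'
  rwa [conjTranspose_mul, Matrix.mul_assoc, ← Matrix.mul_assoc U, hU1, Matrix.one_mul] at h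


/-- The coupling of the core in block form: for `H = EEᴴ` with blocks `H₁₁ = XXᴴ`, `H₁₂ = XYᴴ`,
`H₂₁ = YXᴴ` one has `(AX + BY)Xᴴ + X(AX + BY)ᴴ = AH₁₁ + H₁₁Aᴴ + BH₂₁ + H₁₂Bᴴ`.
[cite: Megretski2010, §3.2.5 («`E₀HE₀' = E₁HE₁'`», continuous-time form)] -/
theorem coupling_eq_blocks (A : Matrix n n ℂ) (B : Matrix n m ℂ) (E : Matrix (n ⊕ m) r ℂ) :
    (A * E.toRows₁ + B * E.toRows₂) * E.toRows₁ᴴ + E.toRows₁ * (A * E.toRows₁ + B * E.toRows₂)ᴴ =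
      A * (E * Eᴴ).toBlocks₁₁ + (E * Eᴴ).toBlocks₁₁ * Aᴴ + B * (E * Eᴴ).toBlocks₂₁ +
        (E * Eᴴ).toBlocks₁₂ * Bᴴ := by
  have hE : E * Eᴴ = fromBlocks (E.toRows₁ * E.toRows₁ᴴ) (E.toRows₁ * E.toRows₂ᴴ)
      (E.toRows₂ * E.toRows₁ᴴ) (E.toRows₂ * E.toRows₂ᴴ) := by
    conv_lhs => rw [← fromRows_toRows E]
    rw [conjTranspose_fromRows_eq_fromCols_conjTranspose, fromRows_mul_fromCols]
  rw [hE, toBlocks_fromBlocks₁₁, toBlocks_fromBlocks₁₂, toBlocks_fromBlocks₂₁, conjTranspose_add,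
    conjTranspose_mul, conjTranspose_mul, Matrix.add_mul, Matrix.mul_add]
  simp only [Matrix.mul_assoc]
  abel

end Core


/-! ## §3 The strict KYP lemma for real data (Megretski §1.2 `thm:kyplmisct`; Rantzer Thm 1, strict part) -/

section RealStrict

variable {n m : Type*} [Fintype n] [Fintype m] [DecidableEq n] [DecidableEq m]

omit [Fintype m] [DecidableEq m] in
/-- A real positive semidefinite matrix stays positive semidefinite over `ℂ`. [folklore] -/
private theorem posSemidef_map_ofRealHom {p : Type*} [Fintype p] [DecidableEq p]
    {M : Matrix p p ℝ} (hM : M.PosSemidef) : (M.map Complex.ofRealHom).PosSemidef := by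
  open scoped MatrixOrder in
  obtain ⟨C, hC⟩ := CStarAlgebra.nonneg_iff_eq_star_mul_self.mp hM.nonneg
  rw [hC, Matrix.star_eq_conjTranspose, Matrix.map_mul,
    Matrix.conjTranspose_map _ (fun a => by simp)]
  exact Matrix.posSemidef_conjTranspose_mul_self _

omit [Fintype m] [DecidableEq m] in
/-- A real positive definite matrix stays positive definite over `ℂ`. [folklore] -/
private theorem posDef_map_ofRealHom {p : Type*} [Fintype p] [DecidableEq p]
    {M : Matrix p p ℝ} (hM : M.PosDef) : (M.map Complex.ofRealHom).PosDef := by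
  refine (posSemidef_map_ofRealHom hM.posSemidef).posDef_iff_det_ne_zero.mpr ?_
  rw [← RingHom.mapMatrix_apply, ← RingHom.map_det, Complex.ofRealHom_eq_coe,
    Complex.ofReal_ne_zero]
  exact hM.det_pos.ne'

/-- **Strict KYP lemma, easy half `(a) ⇒ (b)`.**  If a real symmetric `P` makes
`Q + [AᵀP + PA, PB; BᵀP, 0]` positive definite, then the Hermitian form of `Q` is positive definite
on every `L(iω) = {(x, u) ∈ ℂⁿ × ℂᵐ : iωx = Ax + Bu}`, `ω ∈ ℝ`, and on `L(∞) = {0} × ℂᵐ`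
(«substituting a non-zero pair `(x, u)` from `L(z)` … yields `σ(x,u) = σ_P(x,u) > 0`»: the form
of `[AᵀP + PA, PB; BᵀP, 0]` is `2 Re[xᴴP(Ax + Bu)] = 2 Re(iω · xᴴPx) = 0` on `L(iω)`).
[cite: Megretski2010, §1.2 strict-LMI continuous-time theorem (`thm:kyplmisct`), (a) ⇒ (b), proof §3.2.5 first paragraph; Rantzer1996, Thm 1 (ii) ⇒ (i)] -/
theorem freq_pos_of_certificate (A : Matrix n n ℝ) (B : Matrix n m ℝ)
    (Q : Matrix (n ⊕ m) (n ⊕ m) ℝ) {P : Matrix n n ℝ} (hP : Pᵀ = P)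
    (hQP : (Q + fromBlocks (Aᵀ * P + P * A) (P * B) (Bᵀ * P) 0).PosDef) :
    (∀ (ω : ℝ) (x : n → ℂ) (u : m → ℂ),
        A.map Complex.ofRealHom *ᵥ x + B.map Complex.ofRealHom *ᵥ u = ((ω : ℂ) * I) • x →
        Sum.elim x u ≠ 0 →
        0 < (star (Sum.elim x u) ⬝ᵥ (Q.map Complex.ofRealHom *ᵥ Sum.elim x u)).re) ∧
      (∀ u : m → ℂ, u ≠ 0 →
        0 < (star (Sum.elim (0 : n → ℂ) u) ⬝ᵥ (Q.map Complex.ofRealHom *ᵥ Sum.elim 0 u)).re) := by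
  have hC := posDef_map_ofRealHom hQP
  rw [Matrix.map_add _ (map_add Complex.ofRealHom), kyp_map_ofReal] at hC
  -- the form of the KYP block vanishes on `L(iω)` and on `L(∞)`
  have hvan : ∀ (ω : ℝ) (x : n → ℂ) (u : m → ℂ),
      A.map Complex.ofRealHom *ᵥ x + B.map Complex.ofRealHom *ᵥ u = ((ω : ℂ) * I) • x →
      (star (Sum.elim x u) ⬝ᵥ (fromBlocks ((A.map Complex.ofRealHom)ᴴ * P.map Complex.ofRealHom +
          P.map Complex.ofRealHom * A.map Complex.ofRealHom)
        (P.map Complex.ofRealHom * B.map Complex.ofRealHom)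
        ((B.map Complex.ofRealHom)ᴴ * P.map Complex.ofRealHom) 0 *ᵥ Sum.elim x u)).re = 0 := by
    intro ω x u hxu
    have hPh : (P.map Complex.ofRealHom)ᴴ = P.map Complex.ofRealHom := by
      rw [← Matrix.conjTranspose_map _ (fun a => by simp), conjTranspose_eq_transpose_of_trivial,
        hP]
    have hreal : star (star x ⬝ᵥ (P.map Complex.ofRealHom *ᵥ x)) =
        star x ⬝ᵥ (P.map Complex.ofRealHom *ᵥ x) := by
      conv_lhs => rw [star_dotProduct, star_star, star_mulVec, hPh, ← dotProduct_mulVec]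
    rw [star_dotProduct_kyp_mulVec, hxu, star_smul, mulVec_smul, smul_dotProduct, dotProduct_smul,
      smul_eq_mul, smul_eq_mul, ← add_mul, Complex.mul_re]
    have him : (star ((ω : ℂ) * I) + (ω : ℂ) * I) = 0 := by
      simp
    rw [him]
    simp
  refine ⟨fun ω x u hxu hne => ?_, fun u hu => ?_⟩
  · have hpos := (Complex.pos_iff.mp (hC.dotProduct_mulVec_pos hne)).1
    rwa [add_mulVec, dotProduct_add, Complex.add_re, hvan ω x u hxu, add_zero] at hpos
  · have hne : Sum.elim (0 : n → ℂ) u ≠ 0 := by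
      intro h
      apply hu
      funext j
      exact congrFun h (Sum.inr j)
    have hpos := (Complex.pos_iff.mp (hC.dotProduct_mulVec_pos hne)).1
    have h0 : A.map Complex.ofRealHom *ᵥ (0 : n → ℂ) + B.map Complex.ofRealHom *ᵥ u =
        A.map Complex.ofRealHom *ᵥ 0 + B.map Complex.ofRealHom *ᵥ u := rfl
    rw [add_mulVec, dotProduct_add, Complex.add_re] at hpos
    have hv : (star (Sum.elim (0 : n → ℂ) u) ⬝ᵥ (fromBlocks ((A.map Complex.ofRealHom)ᴴ *
        P.map Complex.ofRealHom + P.map Complex.ofRealHom * A.map Complex.ofRealHom)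
        (P.map Complex.ofRealHom * B.map Complex.ofRealHom)
        ((B.map Complex.ofRealHom)ᴴ * P.map Complex.ofRealHom) 0 *ᵥ Sum.elim 0 u)).re = 0 := by
      rw [star_dotProduct_kyp_mulVec, mulVec_zero, mulVec_zero, dotProduct_zero, star_zero,
        zero_dotProduct, add_zero, Complex.zero_re]
    rwa [hv, add_zero] at hpos


omit [DecidableEq n] in
/-- Trace against a symmetric elementary matrix: `tr((E_ab + E_ba) N) = N_ba + N_ab`. [folklore] -/
private theorem trace_single_add_single_mul [DecidableEq n] (a b : n) (N : Matrix n n ℝ) :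
    trace ((single a b (1 : ℝ) + single b a 1) * N) = N b a + N a b := by
  have h : ∀ i j : n, trace (single i j (1 : ℝ) * N) = N j i := by
    intro i j
    rw [trace]
    simp only [diag_apply]
    rw [Finset.sum_eq_single_of_mem i (Finset.mem_univ i)
      (fun k _ hki => single_mul_apply_of_ne (1 : ℝ) i j k k hki N)]
    rw [single_mul_apply_same, one_mul]
  rw [Matrix.add_mul, trace_add, h, h]

/-- **Strict KYP lemma, hard half `(b) ⇒ (a)` (real data).**  Let `A ∈ ℝ^{n×n}`, `B ∈ ℝ^{n×m}`,
`Q = Qᵀ ∈ ℝ^{(n+m)×(n+m)}`.  If the Hermitian form `v ↦ vᴴQv` is positive definite on every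
subspace `L(iω) = {(x, u) ∈ ℂⁿ × ℂᵐ : iωx = Ax + Bu}` (`ω ∈ ℝ`) and on `L(∞) = {0} × ℂᵐ`, then
there is a REAL symmetric `P` with `Q + [AᵀP + PA, PB; BᵀP, 0] ≻ 0`.
Proof as printed: if no `P` exists, the theorem of alternatives for strict LMIs (tree:
`StrictLMIAlternative.exists_dual_of_not_exists_posDef`, B&V Example 5.14 — the Hahn–Banach step
of the source) gives a real `Z ⪰ 0`, `Z ≠ 0`, `tr(QZ) ≤ 0`, orthogonal to the range of
`P ↦ [AᵀP + PA, PB; BᵀP, 0]`, i.e. `AZ₁₁ + Z₁₁Aᵀ + BZ₂₁ + Z₁₂Bᵀ = 0`; factor `Z = RᵀR` and apply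
the complex core `re_trace_mul_pos_of_coupling` to the columns of `Rᵀ`: contradiction.
[cite: Megretski2010, §1.2 strict-LMI continuous-time theorem (`thm:kyplmisct`) incl. «when matrices `A, B, Q` in (b) are real, the corresponding matrix `P` from (a) can be chosen to be real», proof §3.2.5 + §3.2.7; Rantzer1996, Thm 1, strict part («The corresponding equivalence for strict inequalities holds even if `(A, B)` is not controllable»), (i) ⇒ (ii)] -/
theorem exists_certificate_of_freq_pos (A : Matrix n n ℝ) (B : Matrix n m ℝ)
    {Q : Matrix (n ⊕ m) (n ⊕ m) ℝ} (hQ : Qᵀ = Q)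
    (hfreq : ∀ (ω : ℝ) (x : n → ℂ) (u : m → ℂ),
        A.map Complex.ofRealHom *ᵥ x + B.map Complex.ofRealHom *ᵥ u = ((ω : ℂ) * I) • x →
        Sum.elim x u ≠ 0 →
        0 < (star (Sum.elim x u) ⬝ᵥ (Q.map Complex.ofRealHom *ᵥ Sum.elim x u)).re)
    (hinf : ∀ u : m → ℂ, u ≠ 0 →
        0 < (star (Sum.elim (0 : n → ℂ) u) ⬝ᵥ (Q.map Complex.ofRealHom *ᵥ Sum.elim 0 u)).re) :
    ∃ P : Matrix n n ℝ, Pᵀ = P ∧ (Q + fromBlocks (Aᵀ * P + P * A) (P * B) (Bᵀ * P) 0).PosDef := by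
  by_contra hno
  -- the symmetric pencil `x ↦ Σ_{(a,b)} x_{ab} [AᵀS_{ab} + S_{ab}A, S_{ab}B; BᵀS_{ab}, 0]`,
  -- `S_{ab} = E_{ab} + E_{ba}`, and the LMI alternative
  set Sy : n × n → Matrix n n ℝ := fun ab => single ab.1 ab.2 (1 : ℝ) + single ab.2 ab.1 1
    with hSy
  have hSyT : ∀ ab, (Sy ab)ᵀ = Sy ab := fun ab => by
    rw [hSy]
    simp only [transpose_add, transpose_single]
    exact add_comm _ _
  set F : n × n → Matrix (n ⊕ m) (n ⊕ m) ℝ := fun ab =>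
    -fromBlocks (Aᵀ * Sy ab + Sy ab * A) (Sy ab * B) (Bᵀ * Sy ab) 0 with hF
  have hFT : ∀ ab, (F ab)ᵀ = F ab := fun ab => by
    rw [hF]
    simp only [transpose_neg, kyp_transpose A B (hSyT ab)]
  have hGT : (-Q)ᵀ = -Q := by rw [transpose_neg, hQ]
  have hnot : ¬ ∃ x : n × n → ℝ,
      (-Literature.Analysis.Convex.GeneralizedInequalityConstraints.lmiMap F (-Q) x).PosDef := by
    rintro ⟨x, hx⟩
    apply hno
    refine ⟨∑ ab, x ab • Sy ab, ?_, ?_⟩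
    · rw [transpose_sum]
      exact Finset.sum_congr rfl fun ab _ => by rw [transpose_smul, hSyT]
    · have e : -Literature.Analysis.Convex.GeneralizedInequalityConstraints.lmiMap F (-Q) x =
          Q + fromBlocks (Aᵀ * (∑ ab, x ab • Sy ab) + (∑ ab, x ab • Sy ab) * A)
            ((∑ ab, x ab • Sy ab) * B) (Bᵀ * (∑ ab, x ab • Sy ab)) 0 := by
        rw [Literature.Analysis.Convex.GeneralizedInequalityConstraints.lmiMap, kyp_sum,
          neg_add, neg_neg, add_comm, ← Finset.sum_neg_distrib]
        congr 1
        refine Finset.sum_congr rfl fun ab _ => ?_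
        rw [kyp_smul, hF]
        simp only [smul_neg, neg_neg]
      rw [e] at hx
      exact hx
  obtain ⟨Z, hZ, hZ0, hQZ, hFZ⟩ :=
    Literature.Analysis.Convex.StrictLMIAlternative.exists_dual_of_not_exists_posDef hFT hGT hnot
  -- `tr(QZ) ≤ 0`
  have hQZ' : trace (Q * Z) ≤ 0 := by
    rw [Matrix.neg_mul, trace_neg] at hQZ
    linarith
  -- orthogonality to the pencil: `N = AZ₁₁ + Z₁₁Aᵀ + BZ₂₁ + Z₁₂Bᵀ = 0`
  have hZT : Zᵀ = Z := by
    rw [← conjTranspose_eq_transpose_of_trivial]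
    exact hZ.isHermitian
  have hNT : (A * Z.toBlocks₁₁ + Z.toBlocks₁₁ * Aᵀ + B * Z.toBlocks₂₁ + Z.toBlocks₁₂ * Bᵀ)ᵀ =
      A * Z.toBlocks₁₁ + Z.toBlocks₁₁ * Aᵀ + B * Z.toBlocks₂₁ + Z.toBlocks₁₂ * Bᵀ := by
    have h11 : Z.toBlocks₁₁ᵀ = Z.toBlocks₁₁ := by
      ext i j
      exact congrFun (congrFun hZT (Sum.inl i)) (Sum.inl j)
    have h21 : Z.toBlocks₂₁ᵀ = Z.toBlocks₁₂ := by
      ext i j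
      exact congrFun (congrFun hZT (Sum.inl i)) (Sum.inr j)
    have h12 : Z.toBlocks₁₂ᵀ = Z.toBlocks₂₁ := by
      ext i j
      exact congrFun (congrFun hZT (Sum.inr i)) (Sum.inl j)
    rw [transpose_add, transpose_add, transpose_add, transpose_mul, transpose_mul, transpose_mul,
      transpose_mul, transpose_transpose, transpose_transpose, h11, h21, h12]
    abel
  have hN : A * Z.toBlocks₁₁ + Z.toBlocks₁₁ * Aᵀ + B * Z.toBlocks₂₁ + Z.toBlocks₁₂ * Bᵀ = 0 := by
    ext a b
    have h := hFZ (a, b)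
    rw [hF] at h
    simp only [Matrix.neg_mul, trace_neg, neg_eq_zero] at h
    rw [trace_kyp_mul, hSy] at h
    simp only at h
    rw [trace_single_add_single_mul] at h
    have hsym := congrFun (congrFun hNT a) b
    rw [transpose_apply] at hsym
    rw [hsym] at h
    rw [Matrix.zero_apply]
    linarith
  -- factor `Z = RᵀR` and pass to `ℂ`
  open scoped MatrixOrder in
  obtain ⟨R, hR⟩ := CStarAlgebra.nonneg_iff_eq_star_mul_self.mp hZ.nonneg
  set E : Matrix (n ⊕ m) (n ⊕ m) ℂ := (star R).map Complex.ofRealHom with hE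
  have hEE : E * Eᴴ = Z.map Complex.ofRealHom := by
    rw [hE, ← Matrix.conjTranspose_map _ (fun a => by simp), Matrix.star_eq_conjTranspose,
      conjTranspose_conjTranspose, ← Matrix.map_mul, ← Matrix.star_eq_conjTranspose, ← hR]
  have hE0 : E ≠ 0 := by
    intro h
    apply hZ0
    ext i j
    have hij := congrFun (congrFun hEE i) j
    rw [h, Matrix.zero_mul, Matrix.zero_apply, Matrix.map_apply] at hij
    exact (Complex.ofReal_eq_zero.mp hij.symm)
  -- the coupling for `E`
  have hc : (A.map Complex.ofRealHom * E.toRows₁ + B.map Complex.ofRealHom * E.toRows₂) *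
        E.toRows₁ᴴ +
      E.toRows₁ * (A.map Complex.ofRealHom * E.toRows₁ + B.map Complex.ofRealHom * E.toRows₂)ᴴ
        = 0 := by
    rw [coupling_eq_blocks, hEE]
    have hAh : (A.map Complex.ofRealHom)ᴴ = Aᵀ.map Complex.ofRealHom := by
      rw [← Matrix.conjTranspose_map _ (fun a => by simp), conjTranspose_eq_transpose_of_trivial]
    have hBh : (B.map Complex.ofRealHom)ᴴ = Bᵀ.map Complex.ofRealHom := by
      rw [← Matrix.conjTranspose_map _ (fun a => by simp), conjTranspose_eq_transpose_of_trivial]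
    have h11 : (Z.map Complex.ofRealHom).toBlocks₁₁ = Z.toBlocks₁₁.map Complex.ofRealHom := rfl
    have h12 : (Z.map Complex.ofRealHom).toBlocks₁₂ = Z.toBlocks₁₂.map Complex.ofRealHom := rfl
    have h21 : (Z.map Complex.ofRealHom).toBlocks₂₁ = Z.toBlocks₂₁.map Complex.ofRealHom := rfl
    rw [hAh, hBh, h11, h12, h21, ← Matrix.map_mul, ← Matrix.map_mul, ← Matrix.map_mul,
      ← Matrix.map_mul, ← Matrix.map_add _ (map_add Complex.ofRealHom),
      ← Matrix.map_add _ (map_add Complex.ofRealHom), ← Matrix.map_add _ (map_add Complex.ofRealHom),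
      hN, Matrix.map_zero _ (map_zero Complex.ofRealHom)]
  -- the core: `0 < Re tr(Q_ℂ · EEᴴ) = tr(QZ) ≤ 0`
  have hpos := re_trace_mul_pos_of_coupling (A.map Complex.ofRealHom) (B.map Complex.ofRealHom)
    (Q.map Complex.ofRealHom) hfreq hinf hc hE0
  rw [hEE, ← Matrix.map_mul] at hpos
  have htr : ∀ M : Matrix (n ⊕ m) (n ⊕ m) ℝ, (trace (M.map Complex.ofRealHom)).re = trace M := by
    intro M
    simp only [Matrix.trace, Matrix.diag_apply, Matrix.map_apply, Complex.re_sum,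
      Complex.ofRealHom_eq_coe, Complex.ofReal_re]
  rw [htr (Q * Z)] at hpos
  exact absurd hQZ' (not_le.mpr hpos)


/-- **The strict Kalman–Yakubovich–Popov lemma (continuous time, real data; Megretski's form).**
For `A ∈ ℝ^{n×n}`, `B ∈ ℝ^{n×m}`, `Q = Qᵀ ∈ ℝ^{(n+m)×(n+m)}` the following are equivalent:
(a) there is a real symmetric `P` such that the form `σ_P(x,u) = (x;u)ᵀQ(x;u) + 2xᵀP(Ax + Bu)`
is positive definite, i.e. `Q + [AᵀP + PA, PB; BᵀP, 0] ≻ 0`;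
(b) the Hermitian form `v ↦ vᴴQv` is positive definite on the subspace
`L(iω) = {(x, u) ∈ ℂⁿ × ℂᵐ : iωx = Ax + Bu}` for every `ω ∈ ℝ` and on `L(∞) = {0} × ℂᵐ`.
(«Moreover, when matrices `A, B, Q` in (b) are real, the corresponding matrix `P` from (a) can be
chosen to be real as well.»  No controllability or spectral hypothesis on `(A, B)`.)
[cite: Megretski2010, §1.2, strict-LMI continuous-time theorem (LaTeX label `thm:kyplmisct`; the second theorem of §1.2), proof §3.2.5 + §3.2.7; Rantzer1996, Thm 1, strict part] -/
theorem strictKYP_iff (A : Matrix n n ℝ) (B : Matrix n m ℝ) {Q : Matrix (n ⊕ m) (n ⊕ m) ℝ}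
    (hQ : Qᵀ = Q) :
    (∃ P : Matrix n n ℝ, Pᵀ = P ∧ (Q + fromBlocks (Aᵀ * P + P * A) (P * B) (Bᵀ * P) 0).PosDef) ↔
      ((∀ (ω : ℝ) (x : n → ℂ) (u : m → ℂ),
          A.map Complex.ofRealHom *ᵥ x + B.map Complex.ofRealHom *ᵥ u = ((ω : ℂ) * I) • x →
          Sum.elim x u ≠ 0 →
          0 < (star (Sum.elim x u) ⬝ᵥ (Q.map Complex.ofRealHom *ᵥ Sum.elim x u)).re) ∧
        (∀ u : m → ℂ, u ≠ 0 →
          0 < (star (Sum.elim (0 : n → ℂ) u) ⬝ᵥ (Q.map Complex.ofRealHom *ᵥ Sum.elim 0 u)).re)) :=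
  ⟨fun ⟨_, hP, h⟩ => freq_pos_of_certificate A B Q hP h,
    fun h => exists_certificate_of_freq_pos A B hQ h.1 h.2⟩

/-- **The strict KYP lemma in resolvent form (Rantzer's Theorem 1, strict inequalities).**  If
`det(iωI − A) ≠ 0` for all real `ω`, then `L(iω) = {((iωI − A)⁻¹Bu, u)}` and the theorem reads:
there is a real symmetric `P` with `Q + [AᵀP + PA, PB; BᵀP, 0] ≻ 0` iff
`[(iωI − A)⁻¹B; I]ᴴ Q [(iωI − A)⁻¹B; I] ≻ 0` for all `ω ∈ ℝ` and (the point `ω = ∞`) `Q₂₂ ≻ 0`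
(here with `Q` in place of Rantzer's `−M`: his statement is the `≤ 0 / < 0` version, see
`strictKYP_neg_iff`). [cite: Rantzer1996, Thm 1 («Given `A ∈ ℝ^{n×n}`, `B ∈ ℝ^{n×m}`, `M = Mᵀ ∈ ℝ^{(n+m)×(n+m)}`, with `det(jωI − A) ≠ 0` for `ω ∈ ℝ` … (i) … `∀ ω ∈ ℝ ∪ {∞}` … (ii) … The corresponding equivalence for strict inequalities holds even if `(A, B)` is not controllable»), as restated in Megretski2010 §1 (ref. [Ran1]); Megretski2010, §1.2 `thm:kyplmisct`] -/
theorem strictKYP_iff_resolvent (A : Matrix n n ℝ) (B : Matrix n m ℝ)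
    {Q : Matrix (n ⊕ m) (n ⊕ m) ℝ} (hQ : Qᵀ = Q)
    (hA : ∀ ω : ℝ, IsUnit ((((ω : ℂ) * I) • (1 : Matrix n n ℂ) - A.map Complex.ofRealHom).det)) :
    (∃ P : Matrix n n ℝ, Pᵀ = P ∧ (Q + fromBlocks (Aᵀ * P + P * A) (P * B) (Bᵀ * P) 0).PosDef) ↔
      ((∀ (ω : ℝ) (u : m → ℂ), u ≠ 0 →
          0 < (star (Sum.elim
              (((((ω : ℂ) * I) • (1 : Matrix n n ℂ) - A.map Complex.ofRealHom)⁻¹ *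
                B.map Complex.ofRealHom) *ᵥ u) u) ⬝ᵥ
            (Q.map Complex.ofRealHom *ᵥ Sum.elim
              (((((ω : ℂ) * I) • (1 : Matrix n n ℂ) - A.map Complex.ofRealHom)⁻¹ *
                B.map Complex.ofRealHom) *ᵥ u) u)).re) ∧
        (∀ u : m → ℂ, u ≠ 0 →
          0 < (star (Sum.elim (0 : n → ℂ) u) ⬝ᵥ (Q.map Complex.ofRealHom *ᵥ Sum.elim 0 u)).re)) := by
  rw [strictKYP_iff A B hQ]
  refine and_congr_left fun _ => ⟨fun h ω u hu => ?_, fun h ω x u hxu hne => ?_⟩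
  · -- `x = (iωI − A)⁻¹ B u` lies in `L(iω)`
    set x := ((((ω : ℂ) * I) • (1 : Matrix n n ℂ) - A.map Complex.ofRealHom)⁻¹ *
      B.map Complex.ofRealHom) *ᵥ u with hx
    have hxL : A.map Complex.ofRealHom *ᵥ x + B.map Complex.ofRealHom *ᵥ u = ((ω : ℂ) * I) • x := by
      have h1 : (((ω : ℂ) * I) • (1 : Matrix n n ℂ) - A.map Complex.ofRealHom) *ᵥ x =
          B.map Complex.ofRealHom *ᵥ u := by
        rw [hx, ← mulVec_mulVec, mulVec_mulVec, mul_nonsing_inv _ (hA ω), one_mulVec]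
      rw [sub_mulVec, smul_mulVec, one_mulVec] at h1
      rw [← h1]
      abel
    have hne : Sum.elim x u ≠ 0 := by
      intro h0
      apply hu
      funext j
      exact congrFun h0 (Sum.inr j)
    exact h ω x u hxL hne
  · -- conversely every `(x, u) ∈ L(iω)` has `x = (iωI − A)⁻¹ B u` and `u ≠ 0`
    have h1 : (((ω : ℂ) * I) • (1 : Matrix n n ℂ) - A.map Complex.ofRealHom) *ᵥ x =
        B.map Complex.ofRealHom *ᵥ u := by
      rw [sub_mulVec, smul_mulVec, one_mulVec, ← hxu]
      abel
    have hx : x = ((((ω : ℂ) * I) • (1 : Matrix n n ℂ) - A.map Complex.ofRealHom)⁻¹ *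
        B.map Complex.ofRealHom) *ᵥ u := by
      rw [← mulVec_mulVec, ← h1, mulVec_mulVec, nonsing_inv_mul _ (hA ω), one_mulVec]
    have hu : u ≠ 0 := by
      intro hu0
      apply hne
      rw [hx, hu0, mulVec_zero]
      funext i
      cases i <;> rfl
    rw [hx]
    exact h ω u hu

omit [Fintype m] [DecidableEq n] [DecidableEq m] in
/-- `P ↦ [AᵀP + PA, PB; BᵀP, 0]` is odd. [cite: Rantzer1996, Thm 1 (ii); Megretski2010, §1.2 (k15)] -/
theorem kyp_neg (A : Matrix n n ℝ) (B : Matrix n m ℝ) (P : Matrix n n ℝ) :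
    fromBlocks (Aᵀ * (-P) + (-P) * A) ((-P) * B) (Bᵀ * (-P)) (0 : Matrix m m ℝ) =
      -fromBlocks (Aᵀ * P + P * A) (P * B) (Bᵀ * P) 0 := by
  rw [← neg_one_smul ℝ P, kyp_smul, neg_one_smul]

/-- **The strict KYP lemma, `≺ 0` form (Rantzer's sign convention / LMI usage).**  For real
`A, B` and symmetric `Q`: there is a real symmetric `P` with `Q + [AᵀP + PA, PB; BᵀP, 0] ≺ 0` iff
the Hermitian form of `Q` is NEGATIVE definite on every `L(iω)`, `ω ∈ ℝ`, and on `L(∞)` — e.g.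
with `Q` the multiplier matrix of a frequency-domain criterion (circle / Popov / bounded-real /
positive-real type) this turns the strict frequency-domain inequality into strict LMI feasibility.
[cite: Rantzer1996, Thm 1, strict part («`M + [AᵀP + PA, PB; BᵀP, 0] < 0`»); Megretski2010, §1.2 `thm:kyplmisct` applied to `−Q`] -/
theorem strictKYP_neg_iff (A : Matrix n n ℝ) (B : Matrix n m ℝ) {Q : Matrix (n ⊕ m) (n ⊕ m) ℝ}
    (hQ : Qᵀ = Q) :
    (∃ P : Matrix n n ℝ, Pᵀ = P ∧
        (-(Q + fromBlocks (Aᵀ * P + P * A) (P * B) (Bᵀ * P) 0)).PosDef) ↔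
      ((∀ (ω : ℝ) (x : n → ℂ) (u : m → ℂ),
          A.map Complex.ofRealHom *ᵥ x + B.map Complex.ofRealHom *ᵥ u = ((ω : ℂ) * I) • x →
          Sum.elim x u ≠ 0 →
          (star (Sum.elim x u) ⬝ᵥ (Q.map Complex.ofRealHom *ᵥ Sum.elim x u)).re < 0) ∧
        (∀ u : m → ℂ, u ≠ 0 →
          (star (Sum.elim (0 : n → ℂ) u) ⬝ᵥ (Q.map Complex.ofRealHom *ᵥ Sum.elim 0 u)).re < 0)) := by
  have hnegQ : (-Q)ᵀ = -Q := by rw [transpose_neg, hQ]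
  have key := strictKYP_iff A B hnegQ
  have hform : ∀ v : n ⊕ m → ℂ, (star v ⬝ᵥ ((-Q).map Complex.ofRealHom *ᵥ v)).re =
      -(star v ⬝ᵥ (Q.map Complex.ofRealHom *ᵥ v)).re := by
    intro v
    rw [Matrix.map_neg _ (map_neg Complex.ofRealHom), neg_mulVec, dotProduct_neg, Complex.neg_re]
  simp only [hform, neg_pos] at key
  rw [← key]
  constructor
  · rintro ⟨P, hP, h⟩
    refine ⟨-P, by rw [transpose_neg, hP], ?_⟩
    rwa [kyp_neg, ← neg_add]
  · rintro ⟨P, hP, h⟩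
    refine ⟨-P, by rw [transpose_neg, hP], ?_⟩
    rwa [kyp_neg, ← sub_eq_add_neg, neg_sub, sub_eq_add_neg, add_comm]

end RealStrict

end Literature.Analysis.Matrix.KalmanYakubovichPopovLemma
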